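import Summits.QuantumFields.YangMills.Theorems.BalabanUVNodesK0TwoPrimeOfMembershipDomain
import Summits.QuantumFields.YangMills.Theorems.BalabanUVNodesN09B0RiderAtRecord
import Summits.QuantumFields.YangMills.Theorems.BalabanUVNodesN09SelectorContinuousOfThm1TwoRadii

/-!
# K0⁷ — THE COLLAR ROW OF THE №432 DOOR FROM A LIPSCHITZ ROW: «(hS) ⟸ [15] Prop. 9-species Lipschitz stability of the first form + the p. 266–267 rider (dag-n09-w4∕w1) +
# the standard slots», and the door re-issued with NO (2.9)-cutoff left in the producer's [15]-bill

Cell `pub-ymgap`, width seat `pub-ymgap-dag-n07-w3` (g20; N07 [B11] ∕ K0⁷ junction).  `--kind proof --supports stmt-QuantumFields-20541 --as helper`, COUNT-NEUTRAL.  NEW leaf;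
theorems only — 0 `def`, 0 `sorry`, 0 `instance`, 0 `notation`.  Imports this seat's g20 file 2 `…K0TwoPrimeOfMembershipDomain` (door with `U := Node00.domUOfRecord` pinned; carries
file 1 `…Thm1Slots` and g19's chain) and dag-n09-w4∕w1's `…N09B0RiderAtRecord` (`hb0_of_hsolν_of_numerics`: the NONLINEAR p. 266–267 rider — on a solvable small coarse field,
`χ^{(2.9)}_k(V) = 1` forces the EXCLUDED variables `b₀(c)` to be `10(d+2)L·L^{d−1}·ε₂₉`-close to the critical configuration `V^{(k)}(V̄)` as well).  [I] = [Balaban1987RG1];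
[15] = [Balaban1985Variational]; [B7] = [Balaban1985Averaging].

WHY.  After files 1–2 the ONE row of the door «2′ ⟸ box at ONE radius ā» that still names the (2.9) cutoff is the COLLAR row (hS): «a level-`k` field `V` whose average is first-form at
level `k+1` and at which `χ^{(2.9)}_{k,ā}(V) ≠ 0` is first-form at level `k`».  Its content is two-fold: (i) GEOMETRY of the cutoff — `χ = 1` puts every NON-distinguished bond variable of `V`
within `ε₂₉` of `V^{(k)} := Ū^k(U_{k+1}(ā; V̄))` ([I] (2.9)), and the rider puts the distinguished ones `b₀(c)` within `ε′ = 60L⁴ε₂₉` (`d = 4`) — a TREE THEOREM (dag-n09-w4 g5 ∕ n09-w1,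
`…N09B0RiderAtRecord`); (ii) ANALYSIS — the first form is LIPSCHITZ-STABLE under bond perturbations of the datum: if every radius-`ā` minimiser over `V′` is `r·η_k²`-regular and `V` is
`t`-close to `V′` bondwise, the radius-`ā` problem at `V` is solvable and every minimiser is `(r + B_L·t)·η_k²`-regular — [15] Sect. G ∕ Prop. 9 p. 309 species («`U_k(V)` … is an analytic
function of `V`», the functional derivative (182) obeying (190)), NOT in the tree.  Since `V^{(k)}` is first-form of membership `ρ∕L²` (restriction + uniqueness from the slots — file 1 — and
`η_{k+1}² = η_k²∕L²`), (hS) follows with membership `ρ∕L² + B_L·60L⁴ε₂₉ ≤ ρ`: a floor on `ρ` proportional to `ε₂₉`, exactly this seat's g19 LOCATED-2 recursion `ρ_k ≤ ρ_{k+1}∕L² + B″C·ε₂₉`.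
THIS FILE proves (hS) from the displayed Lipschitz row `hLip` + slots + rider + numerics (§2) and re-issues the door (§3): the producer's [15]-side bill is now FIVE PURE VARIATIONAL-PROBLEM
SENTENCES — `hT1`, `hUk`, `h11`, `hLip` (and (I) DERIVED from them at the ceiling, §2b) — none mentioning the cutoff, the transport or β; what else it owes per text radius is NODE O's
box at `ā`, the continuity row (hT) on the
plaquette ball (N09's `hreg` species), numerics on `(ρ, ε₂₉)`, and the (8)-row only beyond the ceiling `α₀`.

CONTENTS.  §1 letters at `d = 4` (`(d+2)L = 6L`, the rider's numerics in `K`-free form, `χ` reads `ν` only through `ν.εreg`).  §2 ★★ `firstForm_of_chiFix29_of_lipschitz` (generic rank `N`):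
(hS) at one `(K, k, V)` from `hLip` at `(K, k)`, the slots `hT1`∕`hUk` at `(K, k)`, `h11` at every level of the `K`-th torus (the rider's solvability input), numerics.  §2b ★★ `interior_of_slots`:
the door's interiority input (I) at radius `ā` from `h11`∕`hUk`∕`hT1` at a LARGER radius `a′ ≤ α₀` (dag-n09-w1 g6 `interior_of_thm1_of_reg8` + dag-n21-c's transfer; `B·δ₁₁ ≤ ā`).  §3 ★★★
`absBetaBoxGZBAt_of_boxAtRadius_of_lipschitz` (`N = 2`): file 2's door with (hS) replaced by `hLip` (door level), (I) DERIVED (`ā < α₀` strict), and the per-radius numerics `60L⁴ε₂₉ ≤ t_L`, `ρ∕L² ≤ r_L`,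
`ρ∕L² + B_L·60L⁴ε₂₉ ≤ ρ`, `1640·(12Lε₂₉ + 18ā)·L⁶ ≤ 1`, `13·(12Lε₂₉ + 18ā)·L³ < δ_{SU(2)}`.  §4 A6: `hLip_levelZero` — the Lipschitz row HOLDS at every member `(K, 0)` with
`B_L = 4` (guards `r_L + 4t_L ≤ ā`); levels `k ≥ 1` are Prop. 9's content, not claimed.

HONEST FRAMING (binding).  A by-name composition; NO β estimate; nothing of Bałaban's asserted.  DISPLAYED: `hT1`, `hUk`, `h11` (as in file 2; (I) is now DERIVED) and `hLip` = LIPSCHITZ STABILITY OF THE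
FIRST FORM ([15] Prop. 9 ∕ (182), (190) species — proved NOWHERE in the tree; INHABITED at every member `(K, 0)` with `B_L = 4` by §4; «OPEN: inhabitation at k ≥ 1 not in tree»), NODE O's box at `ā`, the continuity row (hT), the (8)-row beyond the ceiling, numerics.  None is discharged here.  Stub 2′ OPEN; K0⁷ stmt-QuantumFields-20541 NOT
closed; N07 NOT discharged; COUNT 8∕28 · K 1∕4 UNMOVED; R4 = the CONDITIONAL finite-𝕋⁴ rung `BalabanLadder.UV` at fixed `ε = L^(−K)` only — NOT continuum ∕ ℝ⁴ ∕ OS; the Yang–Mills mass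
gap (Clay) is NOT proved by any of this.  Standard axioms only.
-/

noncomputable section

open MeasureTheory Set Filter Topology
open scoped Matrix.Norms.L2Operator

namespace Summit.QuantumFields.YangMills.BalabanUVNodes.K0TwoPrimeOfLipschitzCollar

open Literature.MathematicalPhysics.QuantumFieldTheory.Balaban1983to89
open Literature.MathematicalPhysics.QuantumFieldTheory.Balaban1983to89.Node00
open Literature.MathematicalPhysics.QuantumFieldTheory.Balaban1983to89.T4Continuum
open Literature.MathematicalPhysics.QuantumFieldTheory.Balaban1983to89.FlowStep
open Literature.MathematicalPhysics.QuantumFieldTheory.Balaban1983to89.B15DeterminingSets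
open Literature.MathematicalPhysics.QuantumFieldTheory.Balaban1983to89.ExpMeanLog (deltaSU deltaSU_pos)
open Literature.MathematicalPhysics.QuantumFieldTheory.Balaban1983to89.B12GaugeOrbits021 (OrbitRel)
open B12Eq019ActionBody (integrand)
open Summit.QuantumFields.YangMills.Theorems.K0V23Defs (AbsBetaBoxAtThm1WitnessCCMGenGridGZBAt)
open Summit.QuantumFields.YangMills.BalabanUVNodes.K0Beta13RadiusBlindFirstForm (bgReg_succ_subset)
open Summit.QuantumFields.YangMills.BalabanUVNodes.N09BackgroundRadiiTransfer (bgReg_mono mem_bgReg_iff_of_orbitRel)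
open Summit.QuantumFields.YangMills.BalabanUVNodes.N09B0RiderAtRecord (hb0_of_hsolν_of_numerics)
open Summit.QuantumFields.YangMills.BalabanUVNodes.N09SelectorContinuousOfThm1TwoRadii (interior_of_thm1_of_reg8)
open Summit.QuantumFields.YangMills.Theorems.N21RegularityTransferJunction (plaqSmall_Uk_of_thm1_objects)
open Summit.QuantumFields.YangMills.BalabanUVNodes.K0TwoPrimeOfFixedRadiusBoxThm1Slots (h53a_at h53b_at eta_succ_sq isBackground_restrict_and_uniqueUkOrbit_of_slots)
open Summit.QuantumFields.YangMills.BalabanUVNodes.K0TwoPrimeOfMembershipDomain (cast_d_add_two_mul_L_sq_div_four cast_L_pow_d_sub_one plaqSmall_two_mul_of_firstForm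
  absBetaBoxGZBAt_of_boxAtRadius_of_membershipDomain)

/-! ## §1  Letters at `d = 4`; `χ^{(2.9)}` reads its numerics carrier only through `ν.εreg` -/

section Letters

variable {F : T4Family} {N : ℕ} [NeZero N]

omit [NeZero N] in
/-- `(d+2)·L = 6L` at the record. [cite: Balaban1987RG1, (0.1) p.251 (bookkeeping)] -/
theorem cast_d_add_two_mul_L (K : ℕ) : ((((F.P K).d + 2) * (F.P K).L : ℕ) : ℝ) = 6 * (F.L : ℝ) := by
  rw [T4Family.P_d, T4Family.P_L]; push_cast; ring

omit [NeZero N] in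
/-- The rider's constant `ε′ = 10·((d+2)L·ε₂₉)·L^{d−1}` is `60L⁴ε₂₉` at `d = 4`. [cite: Balaban1987RG1, p.267 (bookkeeping)] -/
theorem rider_eps_eq (K : ℕ) (ε₂₉ : ℝ) :
    10 * (((((F.P K).d + 2) * (F.P K).L : ℕ) : ℝ) * ε₂₉) * ((F.P K).L : ℝ) ^ ((F.P K).d - 1) = 60 * (F.L : ℝ) ^ 4 * ε₂₉ := by
  rw [cast_d_add_two_mul_L, cast_L_pow_d_sub_one]; ring

omit [NeZero N] in
/-- The rider's inner numeric `2·((d+2)L·ε₂₉) + ((d+2)L)²∕4·(2a∕L²)` is `12Lε₂₉ + 18a` at `d = 4`. [cite: Balaban1987RG1, p.267 (bookkeeping)] -/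
theorem rider_inner_eq (K : ℕ) (ε₂₉ a : ℝ) :
    2 * (((((F.P K).d + 2) * (F.P K).L : ℕ) : ℝ) * ε₂₉) + ((((F.P K).d + 2) * (F.P K).L : ℕ) : ℝ) ^ 2 / 4 * (2 * a / ((F.P K).L : ℝ) ^ 2) =
      12 * (F.L : ℝ) * ε₂₉ + 18 * a := by
  have hL : ((F.L : ℕ) : ℝ) ≠ 0 := by exact_mod_cast (ne_of_gt (lt_trans zero_lt_one F.hL.2))
  rw [cast_d_add_two_mul_L_sq_div_four, cast_d_add_two_mul_L, T4Family.P_L]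
  field_simp
  ring

/-- **`χ^{(2.9)}` READS ITS NUMERICS CARRIER ONLY THROUGH `ν.εreg`** (the radius of the background inside `V^{(k)} = Ū^k(U_{k+1}(ν.εreg; ·))`): two carriers with the same `εreg` have the
same cutoff — in particular the door's zero member and the `δ₁₁`-member of this file. [cite: Balaban1987RG1, (2.3) p.265 and (2.9) p.266 (bookkeeping)] -/
theorem chiFix29OfRecord_congr_εreg {ν ν' : Stage7Numerics} (h : ν.εreg = ν'.εreg) (ε₁ : ℝ) (K k : ℕ) :
    chiFix29OfRecord F N ν ε₁ K k = chiFix29OfRecord F N ν' ε₁ K k := by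
  funext V
  unfold chiFix29OfRecord fluctDevOfRecord critCfgOfRecord
  rw [h]

end Letters

/-! ## §2  The collar row from the Lipschitz row, the rider and the slots -/

section Collar

variable {F : T4Family} {N : ℕ} [NeZero N]

/-- ★★ **THE COLLAR ROW (hS) FROM LIPSCHITZ STABILITY OF THE FIRST FORM + THE RIDER + THE SLOTS** — member `(K, k)`, `k < K`, radius `a`, membership `ρ`, threshold `δ₁₁`.  Let `V` be a
level-`k` field whose average `V̄` is first-form at level `k+1` (radius `a`, membership `ρ`) and with `χ^{(2.9)}_{k,a}(V) ≠ 0`.  Then `V` is first-form at level `k` (radius `a`, membership `ρ`).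
ROAD: `V^{(k)} := Ū^k(U_{k+1}(a; V̄))` is first-form at level `k` of membership `ρ∕L²` (file 1's `isBackground_restrict_and_uniqueUkOrbit_of_slots` from `hT1`∕`hUk`∕`h11`, `η_{k+1}² = η_k²∕L²`);
`χ = 1` ⟹ non-distinguished bond variables of `V` within `ε₂₉` of `V^{(k)}` ([I] (2.9), definitional), distinguished ones within `60L⁴ε₂₉` (the RIDER `hb0_of_hsolν_of_numerics`, whose
solvability input on the plaquette ball is `h11`); the displayed LIPSCHITZ row `hLip` at `(V, V^{(k)}, t = 60L⁴ε₂₉, r = ρ∕L²)` then gives solvability at `V` and membership `ρ∕L² + B_L·t ≤ ρ`.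
CONDITIONAL on `hLip` ([15] Prop. 9 species) and the slots; nothing of Bałaban's asserted. [cite: Balaban1987RG1, (2.3) p.265, (2.9) p.266 and p.267, (1.1)–(1.2) p.260; Balaban1985Variational, Prop. 9 p.309, (181)–(182) p.307, (190) p.308, Thm 1 (6),(8)–(10) p.279; Balaban1985Averaging, Prop. 2 (53) p.26] -/
theorem firstForm_of_chiFix29_of_lipschitz (K k : ℕ) (hk : k < K) {a ρ δ₁₁ α₀ α₁ B tL rL BL ε₂₉ : ℝ}
    (ha : 0 < a) (haα : a ≤ α₀) (hB : 0 ≤ B) (ha53a : 143 * 256 * a ≤ 1 / 3) (ha53b : 2 * a ≤ 2 * deltaSU (Fin N) / (8 * (F.L : ℝ)) ^ 2)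
    (hρ : 0 < ρ) (h53a : 143 * 256 * ρ ≤ 1 / 3) (h53b : 2 * ρ ≤ 2 * deltaSU (Fin N) / (8 * (F.L : ℝ)) ^ 2)
    (hδ : 2 * ρ ≤ δ₁₁) (hα₁ : 2 * ρ ≤ α₁) (hBρ : 2 * B * ρ ≤ a) (hε29 : 0 ≤ ε₂₉)
    (hn1 : 1640 * (12 * (F.L : ℝ) * ε₂₉ + 18 * a) * (F.L : ℝ) ^ 6 ≤ 1) (hn2 : 13 * (12 * (F.L : ℝ) * ε₂₉ + 18 * a) * (F.L : ℝ) ^ 3 < deltaSU (Fin N))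
    (htL : 60 * (F.L : ℝ) ^ 4 * ε₂₉ ≤ tL) (hrL : ρ / (F.L : ℝ) ^ 2 ≤ rL) (hLρ : ρ / (F.L : ℝ) ^ 2 + BL * (60 * (F.L : ℝ) ^ 4 * ε₂₉) ≤ ρ)
    (hT1 : ∀ ε₁ : ℝ, 0 < ε₁ → ε₁ ≤ α₁ → ∀ V : GaugeField (F.P K) k (SU N), PlaqSmall ε₁ V →
      (∃ U : GaugeField (F.P K) 0 (SU N), IsBackground (avOfRecord F N K) {U | InUkClassB11 F N K k (B * ε₁) U} k V U) ∧
      (∀ ε₀ : ℝ, B * ε₁ ≤ ε₀ → ε₀ ≤ α₀ → ∀ U U' : GaugeField (F.P K) 0 (SU N),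
          IsBackground (avOfRecord F N K) {U | InUkClassB11 F N K k (B * ε₁) U} k V U →
          IsBackground (avOfRecord F N K) {U | InUkClassB11 F N K k ε₀ U} k V U' → InUkClassB11 F N K k ε₀ U ∧ OrbitRel k U U'))
    (hUk : ∀ (V : GaugeField (F.P K) k (SU N)) (δ : ℝ), 0 < δ → δ ≤ α₁ → B * δ ≤ a → PlaqSmall δ V →
      UkExists F N K k a V ∧ InUkClassB11 F N K k a (Uk F N K k a V))
    (h11 : ∀ (j : ℕ) (V : GaugeField (F.P K) j (SU N)), PlaqSmall δ₁₁ V → UkExists F N K j a V ∧ UniqueUkOrbit F N K j a V)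
    (hLip : ∀ (V V' : GaugeField (F.P K) k (SU N)) (t r : ℝ), 0 ≤ t → t ≤ tL → 0 < r → r ≤ rL →
      (∀ b, dist1 ((V' b)⁻¹ * V b) ≤ t) →
      (UkExists F N K k a V' ∧ ∀ U₁, IsBackground (avOfRecord F N K) (bgReg F N K k a) k V' U₁ → U₁ ∈ bgReg F N K k r) →
      (UkExists F N K k a V ∧ ∀ U₁, IsBackground (avOfRecord F N K) (bgReg F N K k a) k V U₁ → U₁ ∈ bgReg F N K k (r + BL * t)))
    {V : GaugeField (F.P K) k (SU N)}
    (hW : UkExists F N K (k + 1) a ((avOfRecord F N K k).avg V) ∧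
      ∀ U₁, IsBackground (avOfRecord F N K) (bgReg F N K (k + 1) a) (k + 1) ((avOfRecord F N K k).avg V) U₁ → U₁ ∈ bgReg F N K (k + 1) ρ)
    (hz : chiFix29OfRecord F N (numerics7OfThm1CCM F.L 0 δ₁₁ 0 0 a 0) ε₂₉ K k V ≠ 0) :
    UkExists F N K k a V ∧ ∀ U₁, IsBackground (avOfRecord F N K) (bgReg F N K k a) k V U₁ → U₁ ∈ bgReg F N K k ρ := by
  -- the `δ₁₁`-member and its numerics carrier (`εreg = a`, `ε₀ = δ₁₁`, `ε₂₉` — all `rfl`)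
  set θ := theta13OfThm1CCMWZB F N 0 (1 / 2) a δ₁₁ ε₂₉ 0 0 a 0 (fun _ _ => 0) (fun _ _ => 0) with hθ
  have hreg : θ.ν.εreg = a := rfl
  have hε0 : θ.ν.ε₀ = δ₁₁ := rfl
  have h29 : θ.ε₂₉ = ε₂₉ := rfl
  have hν : θ.ν = numerics7OfThm1CCM F.L 0 δ₁₁ 0 0 a 0 := rfl
  have hL1 : (1 : ℝ) ≤ (F.L : ℝ) := by exact_mod_cast F.hL.2.le
  have hL0 : (0 : ℝ) < (F.L : ℝ) := by linarith
  -- the averaged datum is in the threshold ball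
  obtain ⟨hexW, hregW⟩ := hW
  have hW2 : PlaqSmall (2 * ρ) ((avOfRecord F N K k).avg V) := plaqSmall_two_mul_of_firstForm hρ h53a h53b ⟨hexW, hregW⟩
  have havg : (avOfRecord F N K k).avg V ∈ domAltOfRecord F N θ.ν K (k + 1) :=
    (mem_domAltOfRecord_iff F N θ.ν K (k + 1) _).2 fun p => (hW2 p).trans_le (by rw [hε0]; exact hδ)
  -- the reference field `V^{(k)} = Ū^k(U_{k+1}(a; V̄))` is first-form of membership `ρ∕L²`
  have hL2 : (1 : ℝ) ≤ (F.L : ℝ) ^ 2 := one_le_pow₀ hL1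
  have hδL : 2 * ρ ≤ δ₁₁ * (F.L : ℝ) ^ 2 := hδ.trans (le_mul_of_one_le_right (by linarith) hL2)
  have hα₁L : 2 * ρ ≤ α₁ * (F.L : ℝ) ^ 2 := hα₁.trans (le_mul_of_one_le_right (by linarith) hL2)
  obtain ⟨hR, hQ⟩ := isBackground_restrict_and_uniqueUkOrbit_of_slots K k ha haα hρ h53a h53b hδL hα₁L hB hBρ hT1 hUk (h11 k) hexW hregW
  have hmem' : Uk F N K (k + 1) a ((avOfRecord F N K k).avg V) ∈ bgReg F N K k (ρ / (F.L : ℝ) ^ 2) := by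
    have h := hregW _ (isBackground_Uk hexW)
    rw [mem_bgReg_iff] at h ⊢
    intro p
    have hp := h p
    rw [eta_succ_sq] at hp
    calc dist1 (GaugeField.plaqHol (Uk F N K (k + 1) a ((avOfRecord F N K k).avg V)) p) < ρ * ((F.P K).eta k ^ 2 / (F.L : ℝ) ^ 2) := hp
      _ = ρ / (F.L : ℝ) ^ 2 * (F.P K).eta k ^ 2 := by ring
  have hff' : UkExists F N K k a (critCfgOfRecord F N θ.ν K k ((avOfRecord F N K k).avg V)) ∧
      ∀ U₁, IsBackground (avOfRecord F N K) (bgReg F N K k a) k (critCfgOfRecord F N θ.ν K k ((avOfRecord F N K k).avg V)) U₁ →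
        U₁ ∈ bgReg F N K k (ρ / (F.L : ℝ) ^ 2) := by
    rw [critCfgOfRecord_def, hreg]
    exact ⟨⟨_, hR⟩, fun U₁ h₁ => (mem_bgReg_iff_of_orbitRel (hQ _ _ h₁ hR)).2 hmem'⟩
  -- `χ = 1` at the `δ₁₁`-member (same `εreg` as the statement's carrier)
  have hχ1 : chiβOfRecord₁₃ F N θ K (fun _ => 0) k V = 1 := by
    have h01 := chiFix29OfRecord_eq_zero_or_one (F := F) (N := N) (numerics7OfThm1CCM F.L 0 δ₁₁ 0 0 a 0) ε₂₉ K k V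
    exact h01.resolve_left hz
  -- bondwise closeness of `V` to `V^{(k)}`: non-distinguished bonds by (2.9), distinguished ones by the rider
  have ht0 : 0 ≤ 60 * (F.L : ℝ) ^ 4 * ε₂₉ := by positivity
  have hε₂₉t : ε₂₉ ≤ 60 * (F.L : ℝ) ^ 4 * ε₂₉ := by
    have h1 : (1 : ℝ) ≤ 60 * (F.L : ℝ) ^ 4 := by nlinarith [one_le_pow₀ (n := 4) hL1]
    nlinarith
  have hclose : ∀ b : PBond (F.P K) k, dist1 ((critCfgOfRecord F N θ.ν K k ((avOfRecord F N K k).avg V) b)⁻¹ * V b) ≤ 60 * (F.L : ℝ) ^ 4 * ε₂₉ := by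
    intro b
    rw [← fluctDevOfRecord_apply]
    by_cases hb : IsB0 b
    · have h := hb0_of_hsolν_of_numerics θ K (fun _ => 0) (by rw [hreg]; exact ha) (by rw [hreg]; exact h53a_at K ha53a) (by rw [hreg]; exact h53b_at K ha53b)
        (by rw [h29]; exact hε29) (by rw [hreg, h29, rider_inner_eq, cast_L_pow_d_sub_one, ← pow_mul]; exact hn1)
        (by rw [hreg, h29, rider_inner_eq, cast_L_pow_d_sub_one]; exact hn2)
        (fun j _ W hWd => (h11 (j + 1) W (by rw [← hε0]; exact (mem_domAltOfRecord_iff F N θ.ν K (j + 1) W).1 hWd)).1) k hk V havg hχ1 b hb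
      rw [h29, rider_eps_eq] at h
      exact h
    · exact (((chiFix29OfRecord_eq_one_iff θ.ν ε₂₉ K k V).1 hχ1) b hb).le.trans hε₂₉t
  -- the Lipschitz row
  have hρL2 : 0 < ρ / (F.L : ℝ) ^ 2 := by positivity
  obtain ⟨hexV, hregV⟩ := hLip V _ (60 * (F.L : ℝ) ^ 4 * ε₂₉) (ρ / (F.L : ℝ) ^ 2) ht0 htL hρL2 hrL hclose hff'
  exact ⟨hexV, fun U₁ h₁ => bgReg_mono hLρ (hregV U₁ h₁)⟩

end Collar

/-! ## §2b  N07's interiority sentence (I) at the door's radius from the slots at a LARGER radius (dag-n09-w1 g6 `interior_of_thm1_of_reg8`) -/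

section Interior

variable {F : T4Family} {N : ℕ} [NeZero N]

/-- ★★ **THE DOOR's INTERIORITY INPUT (I) IS A CONSEQUENCE OF THE SLOTS AT A LARGER RADIUS.**  Member `(K, k)`, radii `a < a′ ≤ α₀`, threshold `0 < δ₁₁ ≤ α₁` with `B·δ₁₁ ≤ a`: for
`V ∈ PlaqSmall δ₁₁`, every minimiser of the Wilson action over `closure (bgReg a) ∩ 𝔅_k(V)` lies in `bgReg a` — dag-n09-w1 g6's `interior_of_thm1_of_reg8` (two-radii interiority) fed
with `h11` at `a′` (existence ∧ uniqueness) and the (8)-membership `U_k(a′; V) ∈ bgReg a`, the latter from dag-n21-c's transfer `plaqSmall_Uk_of_thm1_objects` (`hT1` + ₈a's rows at `a′`,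
`B·δ₁₁ ≤ a`).  So (I) leaves the door's bill whenever `ā < α₀` strictly.  CONDITIONAL on the slots; nothing of Bałaban's asserted.
[cite: Balaban1985Variational, Thm 1 (6) and (8) p.279, Prop. 7 p.299; Balaban1987RG1, (1.1)–(1.2) p.260] -/
theorem interior_of_slots (K k : ℕ) {a a' δ₁₁ α₀ α₁ B : ℝ} (hlt : a < a') (ha'α : a' ≤ α₀) (hδ : 0 < δ₁₁) (hδα₁ : δ₁₁ ≤ α₁) (hBδ : B * δ₁₁ ≤ a)
    (hT1 : ∀ ε₁ : ℝ, 0 < ε₁ → ε₁ ≤ α₁ → ∀ V : GaugeField (F.P K) k (SU N), PlaqSmall ε₁ V →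
      (∃ U : GaugeField (F.P K) 0 (SU N), IsBackground (avOfRecord F N K) {U | InUkClassB11 F N K k (B * ε₁) U} k V U) ∧
      (∀ ε₀ : ℝ, B * ε₁ ≤ ε₀ → ε₀ ≤ α₀ → ∀ U U' : GaugeField (F.P K) 0 (SU N),
          IsBackground (avOfRecord F N K) {U | InUkClassB11 F N K k (B * ε₁) U} k V U →
          IsBackground (avOfRecord F N K) {U | InUkClassB11 F N K k ε₀ U} k V U' → InUkClassB11 F N K k ε₀ U ∧ OrbitRel k U U'))
    (hUk' : ∀ (V : GaugeField (F.P K) k (SU N)) (δ : ℝ), 0 < δ → δ ≤ α₁ → B * δ ≤ a' → PlaqSmall δ V →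
      UkExists F N K k a' V ∧ InUkClassB11 F N K k a' (Uk F N K k a' V))
    (h11' : ∀ V : GaugeField (F.P K) k (SU N), PlaqSmall δ₁₁ V → UkExists F N K k a' V ∧ UniqueUkOrbit F N K k a' V)
    {V : GaugeField (F.P K) k (SU N)} (hV : PlaqSmall δ₁₁ V) :
    ∀ U₀ : GaugeField (F.P K) 0 (SU N), IsBackground (avOfRecord F N K) (closure (bgReg F N K k a)) k V U₀ → U₀ ∈ bgReg F N K k a := by
  obtain ⟨hex', hun'⟩ := h11' V hV
  have h8 : PlaqSmall (B * δ₁₁ * (F.P K).eta k ^ 2) (Uk F N K k a' V) := plaqSmall_Uk_of_thm1_objects hT1 hUk' ha'α hδ hδα₁ (hBδ.trans hlt.le) hV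
  have hreg8 : Uk F N K k a' V ∈ bgReg F N K k a := by
    rw [mem_bgReg_iff]
    exact fun p => (h8 p).trans_le (mul_le_mul_of_nonneg_right hBδ (sq_nonneg _))
  exact interior_of_thm1_of_reg8 hlt hex' hun' hreg8

end Interior

/-! ## §3  The door re-issued: the Lipschitz row in place of the collar row (`N = 2`) -/

section Door

variable (F : T4Family)

/-- ★★★ **THE DOOR «2′ ⟸ box at ONE fixed radius ā» — [15]-SIDE BILL = FIVE PURE VARIATIONAL-PROBLEM SENTENCES.**  File 2's `absBetaBoxGZBAt_of_boxAtRadius_of_membershipDomain` with the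
per-radius COLLAR row (hS) REPLACED by the door-level LIPSCHITZ row `hLip` (stability of the first form under bondwise `t`-perturbation of the datum, loss `B_L·t` in the membership radius, for
`t ≤ t_L`, `r ≤ r_L`; [15] Prop. 9 ∕ (182), (190) species) and the per-radius numerics `1640·(12Lε₂₉ + 18ā)·L⁶ ≤ 1`, `13·(12Lε₂₉ + 18ā)·L³ < δ_{SU(2)}` (the rider's), `60L⁴ε₂₉ ≤ t_L`,
`ρ∕L² ≤ r_L`, `ρ∕L² + B_L·60L⁴ε₂₉ ≤ ρ` (the collar floor on `ρ`).  Door level: `0 < ā ≤ α₀`, `ā < α` in Berge's window, `0 ≤ B`; `hT1` (Theorem 1 at objects), `hUk` (₈a rows, radii `[ā, α₀]`),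
`h11` ((1.1) on `PlaqSmall δ₁₁`, radii `[ā, α₀]`), `hLip` — and NO interiority row: (I) at `ā` is DERIVED (§2b, dag-n09-w1 g6's two-radii interiority) from the slots at the
ceiling `α₀ > ā` under `0 < δ₁₁ ≤ α₁`, `B·δ₁₁ ≤ ā`.  Per text radius `a₀ > 0` with the [15] antecedents: `γ₀ ε₂₉ β′ ρ`, numerics, NODE O's
box at `ā`, the continuity row (hT) on the plaquette ball, and the selector alternative «down ∨ up-inside-the-window ∨ (8)-row beyond the ceiling».  THEN `K0V23Defs.AbsBetaBoxAtThm1WitnessCCMGenGridGZBAt F`.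
CONDITIONAL on every displayed row; NO β estimate; nothing of Bałaban's asserted. [cite: Balaban1987RG1, Thm 1 p.259, Thm 3 p.264, (1.20)–(1.22) p.264, (1.1)–(1.2) p.260, p.259, (2.3) p.265, (2.9) p.266 and p.267; Balaban1985Variational, Thm 1 (6),(8)–(10) p.279, Prop. 7 p.299, Prop. 9 p.309, (182) p.307, (190) p.308; Balaban1985Averaging, Prop. 2 (53) p.26 (bookkeeping)] -/
theorem absBetaBoxGZBAt_of_boxAtRadius_of_lipschitz (ā δ₁₁ α₀ α₁ B α tL rL BL : ℝ) (hā : 0 < ā) (hāα₀ : ā < α₀) (hB : 0 ≤ B)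
    (hδ₁₁ : 0 < δ₁₁) (hδα₁ : δ₁₁ ≤ α₁) (hBδ : B * δ₁₁ ≤ ā)
    (hāα : ā < α) (hα3 : 143 * 256 * α ≤ 1 / 3) (hα2 : 2 * α ≤ 2 * deltaSU (Fin 2) / (8 * (F.L : ℝ)) ^ 2)
    (hα24 : 9 * (F.L : ℝ) ^ 2 * (2 * α) ≤ 1 / 24) (hαL : 157 * (9 * (F.L : ℝ) ^ 2 * (2 * α)) < ((F.L : ℝ) ^ 3)⁻¹)
    (hT1 : ∀ (K k : ℕ) (ε₁ : ℝ), 0 < ε₁ → ε₁ ≤ α₁ → ∀ V : GaugeField (F.P K) k (Node00.SU 2), PlaqSmall ε₁ V →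
      (∃ U : GaugeField (F.P K) 0 (Node00.SU 2), IsBackground (avOfRecord F 2 K) {U | InUkClassB11 F 2 K k (B * ε₁) U} k V U) ∧
      (∀ ε₀ : ℝ, B * ε₁ ≤ ε₀ → ε₀ ≤ α₀ → ∀ U U' : GaugeField (F.P K) 0 (Node00.SU 2),
          IsBackground (avOfRecord F 2 K) {U | InUkClassB11 F 2 K k (B * ε₁) U} k V U →
          IsBackground (avOfRecord F 2 K) {U | InUkClassB11 F 2 K k ε₀ U} k V U' → InUkClassB11 F 2 K k ε₀ U ∧ OrbitRel k U U'))
    (hUk : ∀ (K k : ℕ) (ε : ℝ), ā ≤ ε → ε ≤ α₀ → ∀ (V : GaugeField (F.P K) k (Node00.SU 2)) (δ : ℝ), 0 < δ → δ ≤ α₁ → B * δ ≤ ε → PlaqSmall δ V →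
      UkExists F 2 K k ε V ∧ InUkClassB11 F 2 K k ε (Uk F 2 K k ε V))
    (h11 : ∀ (K k : ℕ) (ε : ℝ), ā ≤ ε → ε ≤ α₀ → ∀ V : GaugeField (F.P K) k (Node00.SU 2), PlaqSmall δ₁₁ V → UkExists F 2 K k ε V ∧ UniqueUkOrbit F 2 K k ε V)
    (hLip : ∀ (K k : ℕ) (V V' : GaugeField (F.P K) k (Node00.SU 2)) (t r : ℝ), 0 ≤ t → t ≤ tL → 0 < r → r ≤ rL →
      (∀ b, dist1 ((V' b)⁻¹ * V b) ≤ t) →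
      (UkExists F 2 K k ā V' ∧ ∀ U₁, IsBackground (avOfRecord F 2 K) (bgReg F 2 K k ā) k V' U₁ → U₁ ∈ bgReg F 2 K k r) →
      (UkExists F 2 K k ā V ∧ ∀ U₁, IsBackground (avOfRecord F 2 K) (bgReg F 2 K k ā) k V U₁ → U₁ ∈ bgReg F 2 K k (r + BL * t)))
    (h : ∀ a₀ : ℝ, 0 < a₀ →
      (∃ (j c c₀ c₁ : ℕ) (B₃ B₃' a₁ : ℝ), c ≤ F.L ^ j ∧ c₀ ≤ j + 1 ∧ c₁ ≤ j ∧ 2 * (F.L : ℝ) ^ 2 ≤ B₃ ∧ 0 < B₃' ∧ 0 < a₁ ∧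
        VariationalThm1RegSepCoP7MGB F 2
          (fun ν M g K k _s => c ≤ ν.M₁ ∧ k + c₀ ≤ F.m + K ∧ F.L ^ c₁ ∣ M ∧
            ∀ i, 1 ≤ i → i ≤ k → dCubeSide (F.P K).L M (RkOfRecord (F.P K).L ν.r (g i)) i ∣ (F.P K).sitesPerDir 0) (lamDatum F) (dataSmall7LamTopOf F 2) B₃ a₀ a₁ ∧
        Gauge9RegSepTopStepGB F 2 (fun ν K Ω => suppDomOfRecord F ν K Ω) (F.L ^ j)
          (fun ν M g K k _s => c ≤ ν.M₁ ∧ k + c₀ ≤ F.m + K ∧ F.L ^ c₁ ∣ M ∧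
            ∀ i, 1 ≤ i → i ≤ k → dCubeSide (F.P K).L M (RkOfRecord (F.P K).L ν.r (g i)) i ∣ (F.P K).sitesPerDir 0) (lamDatum F) (dataSmall7LamTopOf F 2) B₃ B₃' a₀ a₁) →
      ∃ (γ₀ ε₂₉ β' ρ : ℝ),
        0 < γ₀ ∧ 0 < ε₂₉ ∧ 0 < ρ ∧ 143 * 256 * ρ ≤ 1 / 3 ∧ 2 * ρ ≤ 2 * deltaSU (Fin 2) / (8 * (F.L : ℝ)) ^ 2 ∧
        2 * ρ ≤ δ₁₁ ∧ 2 * ρ ≤ α₁ ∧ 2 * B * ρ ≤ ā ∧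
        1640 * (12 * (F.L : ℝ) * ε₂₉ + 18 * ā) * (F.L : ℝ) ^ 6 ≤ 1 ∧ 13 * (12 * (F.L : ℝ) * ε₂₉ + 18 * ā) * (F.L : ℝ) ^ 3 < deltaSU (Fin 2) ∧
        60 * (F.L : ℝ) ^ 4 * ε₂₉ ≤ tL ∧ ρ / (F.L : ℝ) ^ 2 ≤ rL ∧ ρ / (F.L : ℝ) ^ 2 + BL * (60 * (F.L : ℝ) ^ 4 * ε₂₉) ≤ ρ ∧
        BetaLowerH (-β') γ₀ (betaOfRecord₁₃ F 2 (theta13OfThm1CCMWZB F 2 0 (1 / 2) ā 0 ε₂₉ 0 0 ā 0 (fun _ _ => 0) (fun _ _ => 0))) ∧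
        BetaUpperH β' γ₀ (betaOfRecord₁₃ F 2 (theta13OfThm1CCMWZB F 2 0 (1 / 2) ā 0 ε₂₉ 0 0 ā 0 (fun _ _ => 0) (fun _ _ => 0))) ∧
        (∀ K (g : ℕ → ℝ) k, k < K → {V : GaugeField (F.P K) (k + 1) (Node00.SU 2) | PlaqSmall δ₁₁ V} ⊆ regSetOfRecord F 2 K k
          (integrand (chiFixed29 F 2 (numerics7OfThm1CCM F.L 0 0 0 0 ā 0) ε₂₉ K g k) (gfOfRecord F 2 K k) (g k)
            (effActionHT F 2 (TcanOfRecord F 2) (chiFixed29 F 2 (numerics7OfThm1CCM F.L 0 0 0 0 ā 0) ε₂₉) K g k))) ∧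
        ((a₀ ≤ ā ∧ ρ ≤ a₀) ∨ (ā ≤ a₀ ∧ a₀ ≤ α₀) ∨
          (ā ≤ a₀ ∧ ∀ K k W, k < K →
            (UkExists F 2 K (k + 1) ā W ∧ ∀ U₁, IsBackground (avOfRecord F 2 K) (bgReg F 2 K (k + 1) ā) (k + 1) W U₁ → U₁ ∈ bgReg F 2 K (k + 1) ρ) →
            UkExists F 2 K (k + 1) a₀ W ∧ ∀ U₁, IsBackground (avOfRecord F 2 K) (bgReg F 2 K (k + 1) a₀) (k + 1) W U₁ → U₁ ∈ bgReg F 2 K (k + 1) ā))) :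
    AbsBetaBoxAtThm1WitnessCCMGenGridGZBAt F := by
  have hā53a : 143 * 256 * ā ≤ 1 / 3 := by nlinarith
  have hā53b : 2 * ā ≤ 2 * deltaSU (Fin 2) / (8 * (F.L : ℝ)) ^ 2 := by linarith
  -- the statement's carrier and the `δ₁₁`-member's carrier have the same `εreg = ā`, hence the same cutoff
  have hχ : ∀ (ε₂₉ : ℝ) (K k : ℕ), chiFix29OfRecord F 2 (numerics7OfThm1CCM F.L 0 0 0 0 ā 0) ε₂₉ K k =
      chiFix29OfRecord F 2 (numerics7OfThm1CCM F.L 0 δ₁₁ 0 0 ā 0) ε₂₉ K k := fun ε₂₉ K k => chiFix29OfRecord_congr_εreg rfl ε₂₉ K k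
  -- (I) at the door's radius from the slots at the ceiling `α₀ > ā` (§2b)
  have hI : ∀ (K k : ℕ) (V : GaugeField (F.P K) k (Node00.SU 2)), PlaqSmall δ₁₁ V → ∀ U₀ : GaugeField (F.P K) 0 (Node00.SU 2),
      IsBackground (avOfRecord F 2 K) (closure (bgReg F 2 K k ā)) k V U₀ → U₀ ∈ bgReg F 2 K k ā := fun K k V hV =>
    interior_of_slots K k hāα₀ le_rfl hδ₁₁ hδα₁ hBδ (hT1 K k) (hUk K k α₀ hāα₀.le le_rfl) (h11 K k α₀ hāα₀.le le_rfl) hV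
  refine absBetaBoxGZBAt_of_boxAtRadius_of_membershipDomain F ā δ₁₁ α₀ α₁ B α hā hāα₀.le hB hāα hα3 hα2 hα24 hαL hT1 hUk h11 hI fun a₀ ha₀ hant => ?_
  obtain ⟨γ₀, ε₂₉, β', ρ, hγ₀, hε, hρ, h53a, h53b, hδ, hα₁, hBρ, hn1, hn2, htL, hrL, hLρ, hlo, hup, hT, hsel⟩ := h a₀ ha₀ hant
  refine ⟨γ₀, ε₂₉, β', ρ, hγ₀, hε, hρ, h53a, h53b, hδ, hα₁, hBρ, hlo, hup, ?_, hT, hsel⟩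
  intro K k V hk hW hz
  rw [hχ] at hz
  exact firstForm_of_chiFix29_of_lipschitz K k hk hā hāα₀.le hB hā53a hā53b hρ h53a h53b hδ hα₁ hBρ hε.le hn1 hn2 htL hrL hLρ (hT1 K k)
    (hUk K k ā le_rfl hāα₀.le) (fun j V hV => h11 K j ā le_rfl hāα₀.le V hV) (hLip K k) hW hz

end Door

/-! ## §4  A6: the Lipschitz row at level `0` (where `U_0(V) = V`) holds with `B_L = 4` -/

section LevelZero

variable {F : T4Family} {N : ℕ} [NeZero N]

/-- **THE LIPSCHITZ ROW IS INHABITED AT EVERY MEMBER `(K, 0)` WITH `B_L = 4`** (guards `r_L + 4t_L ≤ a`): at level `0` the only minimiser over `V` is `V` itself (`Ū^0 = id`), a plaquette is a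
four-bond word, so a bondwise `t`-perturbation of an `r`-regular datum is `(r + 4t)`-regular (`dist1_plaqHol_le_add`, `plaqDev_le_four_mul`) and solvable at radius `a ≥ r + 4t`.  Levels `k ≥ 1`
are [15] Prop. 9's content — NOT claimed. [cite: Balaban1985Variational, Prop. 9 p.309 (bookkeeping); Balaban1987RG1, (0.21) p.256, (1.2) p.260] -/
theorem hLip_levelZero (K : ℕ) {a tL rL : ℝ} (hfit : rL + 4 * tL ≤ a) :
    ∀ (V V' : GaugeField (F.P K) 0 (SU N)) (t r : ℝ), 0 ≤ t → t ≤ tL → 0 < r → r ≤ rL →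
      (∀ b, dist1 ((V' b)⁻¹ * V b) ≤ t) →
      (UkExists F N K 0 a V' ∧ ∀ U₁, IsBackground (avOfRecord F N K) (bgReg F N K 0 a) 0 V' U₁ → U₁ ∈ bgReg F N K 0 r) →
      (UkExists F N K 0 a V ∧ ∀ U₁, IsBackground (avOfRecord F N K) (bgReg F N K 0 a) 0 V U₁ → U₁ ∈ bgReg F N K 0 (r + 4 * t)) := by
  intro V V' t r _ htL _ hrL hclose hff
  obtain ⟨hex', hreg'⟩ := hff
  have hV'r : V' ∈ bgReg F N K 0 r :=
    hreg' V' ((B11Thm1LevelZero.isBackground_zero_iff _ _ V' V').2 ⟨rfl, Node00.ukExists_zero_iff.1 hex'⟩)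
  have hη : (F.P K).eta 0 = 1 := by simp [Params.eta]
  have hVreg : ∀ s : ℝ, r + 4 * t ≤ s → V ∈ bgReg F N K 0 s := by
    intro s hs
    rw [mem_bgReg_iff]
    intro p
    have h1 := T4ExpWindowSmallField.dist1_plaqHol_le_add V V' p
    have h2 := ((mem_bgReg_iff F N K 0 r V').1 hV'r) p
    have h3 : T4ExpWindowSmallField.plaqDev V V' p ≤ 4 * t := T4ExpWindowSmallField.plaqDev_le_four_mul hclose p
    rw [hη] at h2 ⊢
    linarith
  refine ⟨Node00.ukExists_zero_iff.2 (hVreg a (by linarith)), fun U₁ h₁ => ?_⟩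
  obtain ⟨rfl, -⟩ := (B11Thm1LevelZero.isBackground_zero_iff _ _ V U₁).1 h₁
  exact hVreg _ le_rfl

end LevelZero

end Summit.QuantumFields.YangMills.BalabanUVNodes.K0TwoPrimeOfLipschitzCollar
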